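import Mathlib
import Summits.AtomisticToContinuum.FouriersLaw.Theorems.ContactStieltjesMeasureContactMeasureLimitAprioriBound
import Summits.AtomisticToContinuum.FouriersLaw.Theorems.ContactStieltjesMeasureContactMeasureLimitHelly
import Summits.AtomisticToContinuum.FouriersLaw.Theorems.ContactStieltjesMeasureContactMeasureLimitSqMeasure
import Summits.AtomisticToContinuum.FouriersLaw.Theorems.ContactStieltjesMeasureContactMeasureLimitLimitData

/-!
# The Stieltjes continuity theorem for the contact kernel
# (glue for crux `ContactMeasureLimit`, line `IdeatorOneSketch`; the registered stub `stub_stieltjesContinuity`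
# of lines `birth` / `escape-import` and child 1 of SPLIT-PROPOSAL.md, PROVED)

Crux `ContactStieltjesMeasure.ContactMeasureLimit` (stmt-AtomisticToContinuum-15250). THE ANALYSIS CHILD of the
crux: monotone `F_N : ℝ → ℝ` vanishing on `(-∞,0]`, each bounded, whose contact transforms
`∫₀^∞ F_N(t)·2t/(γ²+t²)² dt` converge for every friction `γ > 0`, converge themselves at every continuity point
`t > 0` of some monotone `M`.

Proof (idea `escaped-mass-stieltjes-constant`): pointwise bounds from ONE friction (`apriori_…`), one Helly
limit `M` along the full sequence (`helly_local`); for an arbitrary subsequence, Helly again, Stieltjes data in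
`N_S` of both limits (`limitData`: escaped mass = Stieltjes constant), uniqueness of the data
(`limitData_unique`), transfer to the functions at continuity points (`sqMeasure_eq_at_continuity`), and the
sub-subsequence principle `Filter.tendsto_of_subseq_tendsto`.
-/

noncomputable section

namespace Summit.AtomisticToContinuum.FouriersLaw.Theorems.ContactMeasureLimit

open MeasureTheory Filter Set Topology

/-- **STIELTJES CONTINUITY THEOREM for the contact kernel `k_γ(t) = 2t/(γ²+t²)²`** (verbatim the registered
stub `stub_stieltjesContinuity` of lines `birth` / `escape-import` of this crux and child 1 `StieltjesContinuity`
of the strategist's split): monotone `F_N` vanishing on `(-∞,0]`, each bounded, whose contact transforms converge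
for every `γ > 0`, converge at every continuity point `t > 0` of some monotone `M`. [folklore] -/
theorem stieltjesContinuity :
    ∀ F : ℕ → ℝ → ℝ,
      (∀ N : ℕ, Monotone (F N) ∧ (∀ s : ℝ, s ≤ 0 → F N s = 0) ∧ (∃ m : ℝ, ∀ s : ℝ, F N s ≤ m)) →
      (∀ γ : ℝ, 0 < γ → ∃ L : ℝ,
        Filter.Tendsto (fun N : ℕ => ∫ t in Set.Ioi (0 : ℝ), F N t * (2 * t / (γ ^ 2 + t ^ 2) ^ 2))
          Filter.atTop (nhds L)) →
      ∃ M : ℝ → ℝ, Monotone M ∧ ∀ t : ℝ, 0 < t → ContinuousAt M t →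
        Filter.Tendsto (fun N : ℕ => F N t) Filter.atTop (nhds (M t)) := by
  intro F hF hconv
  choose! L hL using hconv
  have hbd : ∀ t : ℝ, ∃ C : ℝ, ∀ N : ℕ, F N t ≤ C :=
    apriori_pointwise_bound_of_tendsto F hF (L 1) (hL 1 one_pos)
  -- one Helly limit along the full sequence: this is `M`
  obtain ⟨φ₀, hφ₀, M, hMmono, hM0, hMlim⟩ :=
    helly_local F (fun N => (hF N).1) (fun N => (hF N).2.1) hbd
  refine ⟨M, hMmono, fun t ht hct => ?_⟩
  refine tendsto_of_subseq_tendsto fun ns hns => ?_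
  -- Helly along the subsequence `ns`
  have hbd' : ∀ t : ℝ, ∃ C : ℝ, ∀ n : ℕ, F (ns n) t ≤ C := fun t =>
    (hbd t).imp fun C hC n => hC _
  obtain ⟨φ, hφ, G, hGmono, hG0, hGlim⟩ :=
    helly_local (fun n => F (ns n)) (fun n => (hF _).1) (fun n => (hF _).2.1) hbd'
  -- Stieltjes data of both limits
  obtain ⟨e₀, he₀, q₀, hq₀, hq₀L⟩ :=
    limitData (fun k => F (φ₀ k)) (fun k => hF _) L
      (fun γ hγ => (hL γ hγ).comp hφ₀.tendsto_atTop)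
      (fun t => (hbd t).imp fun C hC k => hC _) M hMmono hM0 hMlim
  obtain ⟨e, he, q, hq, hqL⟩ :=
    limitData (fun k => F (ns (φ k))) (fun k => hF _) L
      (fun γ hγ => ((hL γ hγ).comp hns).comp hφ.tendsto_atTop)
      (fun t => (hbd t).imp fun C hC k => hC _) G hGmono hG0 hGlim
  -- uniqueness of the data and transfer to the point `t`
  obtain ⟨-, hν⟩ := limitData_unique hq₀ hq (fun γ hγ => by rw [hq₀L γ hγ, hqL γ hγ])
  obtain ⟨hctG, hEq⟩ := sqMeasure_eq_at_continuity M G hMmono hGmono hM0 hG0 hν t ht hct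
  refine ⟨φ, ?_⟩
  rw [hEq]
  exact hGlim t ht hctG

end Summit.AtomisticToContinuum.FouriersLaw.Theorems.ContactMeasureLimit

end
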